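import Literature.NumberTheory.LFunctions.PerronTruncatedBounded
import Literature.NumberTheory.BeurlingPrimes.DMVLineShift
import HarnessLib

/-!
# The truncated Perron formula with the line of integration moved to the left

Topic `Literature/NumberTheory/LFunctions`. Everything in this file is PROVED.

The standard second step after the truncated Perron formula (Montgomery–Vaughan, *Multiplicative
Number Theory I*, Cor. 5.3 and §6.2; Titchmarsh §3.12; Davenport §17–§20): for bounded
coefficients `|a(n)| ≤ 1` whose Dirichlet series agrees on the line `Re s = c = 1 + 1/log x`
(`x = N + 1/2`, `N ≥ 3`) with a function `F` HOLOMORPHIC on the closed rectangle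
`[σ₀, c] × [−T, T]` (`0 < σ₀ ≤ 1 ≤ T`), Cauchy's theorem replaces the Perron integral over the
right side by the integrals over the other three sides, whence

`‖∑_{n ≤ N} a(n)‖ ≤ K x log x / T + T · V · x^{σ₀}/σ₀ + (c − σ₀) · W / T`

(`PerronShift.norm_sum_le`), where `V` bounds `‖F‖` on the left side `Re s = σ₀` and `W` bounds
`‖F(σ ± iT)‖ x^σ` on the horizontal sides (`K` the absolute constant of
`PerronBounded.exists_norm_perron_bounded_sub_le`). The caller supplies `F` (typically `1/L(s,χ)`,
`−ζ'/ζ`, …), its holomorphy on the rectangle (a zero-free region) and the two majorants.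

## References

* [MontgomeryVaughan2007] H. L. Montgomery, R. C. Vaughan, *Multiplicative Number Theory I*,
  CUP 2007, Cor. 5.3 and §6.2 (proof of Theorem 6.9).
* [Titchmarsh1986] E. C. Titchmarsh, *The Theory of the Riemann Zeta-Function*, 2nd ed., §3.12.
-/

noncomputable section

open Complex Set MeasureTheory Filter Topology intervalIntegral Real

namespace Literature.NumberTheory.LFunctions

namespace PerronShift

/-- The integrand `F(s) x^s/s` is holomorphic on the rectangle `[σ₀, c] × [−T, T]` (`σ₀, c > 0`)
when `F` is. [folklore] -/
theorem differentiableOn_integrand {F : ℂ → ℂ} {x σ₀ c T : ℝ} (hx : 0 < x) (hσ₀ : 0 < σ₀)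
    (hc : 0 < c) (hF : DifferentiableOn ℂ F (uIcc σ₀ c ×ℂ uIcc (-T) T)) :
    DifferentiableOn ℂ (fun s ↦ F s * ((x : ℂ) ^ s / s)) (uIcc σ₀ c ×ℂ uIcc (-T) T) := by
  intro s hs
  have hre : 0 < s.re := by
    have h := (mem_reProdIm.1 hs).1
    rw [mem_uIcc] at h
    rcases h with h | h <;> linarith [h.1]
  have hs0 : s ≠ 0 := fun h ↦ by rw [h, zero_re] at hre; exact lt_irrefl _ hre
  exact (hF s hs).mul (differentiableAt_cpow_div hx hs0).differentiableWithinAt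

/-- **Perron's formula with the contour moved to `Re s = σ₀`.** There is an absolute `K > 0` such
that: for `|a(n)| ≤ 1`, `N ≥ 3`, `x = N + 1/2`, `c = 1 + 1/log x`, `T ≥ 1`, `0 < σ₀ ≤ 1`, and `F`
holomorphic on `[σ₀, c] × [−T, T]` with `L(a, c + it) = F(c + it)` for all real `t`; if
`‖F(σ₀ + it)‖ ≤ V` for `|t| ≤ T` and `‖F(σ ± iT)‖ x^σ ≤ W` for `σ₀ ≤ σ ≤ c`, then
`‖∑_{1 ≤ n ≤ N} a(n)‖ ≤ K x log x/T + T V x^{σ₀}/σ₀ + (c − σ₀) W/T`.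
[cite: MontgomeryVaughan2007, Cor. 5.3 and §6.2] -/
theorem norm_sum_le :
    ∃ K : ℝ, 0 < K ∧ ∀ a : ℕ → ℂ, (∀ n, ‖a n‖ ≤ 1) → ∀ N : ℕ, 3 ≤ N → ∀ x c : ℝ,
      x = N + 1 / 2 → c = 1 + 1 / Real.log x → ∀ T σ₀ : ℝ, 1 ≤ T → 0 < σ₀ → σ₀ ≤ 1 →
      ∀ F : ℂ → ℂ, DifferentiableOn ℂ F (uIcc σ₀ c ×ℂ uIcc (-T) T) →
        (∀ t : ℝ, LSeries a (c + t * I) = F (c + t * I)) →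
        ∀ V W : ℝ, (∀ t : ℝ, |t| ≤ T → ‖F (σ₀ + t * I)‖ ≤ V) →
          (∀ σ : ℝ, σ₀ ≤ σ → σ ≤ c → ‖F (σ + T * I)‖ * x ^ σ ≤ W) →
          (∀ σ : ℝ, σ₀ ≤ σ → σ ≤ c → ‖F (σ + (-T) * I)‖ * x ^ σ ≤ W) →
            ‖∑ n ∈ Finset.Icc 1 N, a n‖ ≤
              K * x * Real.log x / T + T * V * x ^ σ₀ / σ₀ + (c - σ₀) * W / T := by
  obtain ⟨K, hK0, hK⟩ := PerronBounded.exists_norm_perron_bounded_sub_le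
  refine ⟨K, hK0, fun a ha N hN x c hx hc T σ₀ hT hσ₀ hσ₁ F hF hLF V W hV hW₁ hW₂ ↦ ?_⟩
  obtain ⟨hx0, hlog, hc1, _, _, _⟩ := halfInt_facts hN hx hc
  have hT0 : 0 < T := by linarith
  have hc0 : 0 < c := by linarith
  have hσc : σ₀ ≤ c := by linarith
  -- the integrand and Cauchy's theorem on the rectangle
  set g : ℂ → ℂ := fun s ↦ F s * ((x : ℂ) ^ s / s) with hg
  have hgd : DifferentiableOn ℂ g (uIcc σ₀ c ×ℂ uIcc (-T) T) :=
    differentiableOn_integrand hx0 hσ₀ hc0 hF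
  have hrect := Literature.NumberTheory.BeurlingPrimes.DMV.integral_right_sub_left_eq hgd
  -- Perron on the right side
  have hP := hK a ha N hN x c hx hc T T hT0 hT0
  have hPint : (∫ t in (-T)..T, LSeries a (c + t * I) *
      ((x : ℂ) ^ ((c : ℂ) + t * I) / ((c : ℂ) + t * I))) = ∫ t in (-T)..T, g (c + t * I) :=
    intervalIntegral.integral_congr fun t _ ↦ by simp only [hg, hLF t]
  rw [hPint] at hP
  -- the left side
  have hleft : ‖∫ t in (-T)..T, g (σ₀ + t * I)‖ ≤ V * x ^ σ₀ / σ₀ * |T - -T| := by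
    refine intervalIntegral.norm_integral_le_of_norm_le_const fun t ht ↦ ?_
    have ht' : |t| ≤ T := by
      rw [uIoc_of_le (by linarith)] at ht
      exact abs_le.2 ⟨ht.1.le, ht.2⟩
    rw [hg, norm_mul]
    have h1 := hV t ht'
    have h2 := norm_cpow_div_le_vertical hx0 hσ₀.ne' t
    rw [abs_of_pos hσ₀] at h2
    have hV0 : 0 ≤ V := (norm_nonneg _).trans h1
    calc ‖F (σ₀ + t * I)‖ * ‖(x : ℂ) ^ ((σ₀ : ℂ) + t * I) / ((σ₀ : ℂ) + t * I)‖
        ≤ V * (x ^ σ₀ / σ₀) := mul_le_mul h1 h2 (norm_nonneg _) hV0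
      _ = V * x ^ σ₀ / σ₀ := by ring
  -- the horizontal sides
  have hhor : ∀ T' : ℝ, |T'| = T → (∀ σ : ℝ, σ₀ ≤ σ → σ ≤ c → ‖F (σ + T' * I)‖ * x ^ σ ≤ W) →
      ‖∫ u in σ₀..c, g (u + T' * I)‖ ≤ W / T * |c - σ₀| := by
    intro T' hT' hW
    refine intervalIntegral.norm_integral_le_of_norm_le_const fun u hu ↦ ?_
    rw [uIoc_of_le hσc] at hu
    have hT'0 : T' ≠ 0 := fun h ↦ by rw [h, abs_zero] at hT'; linarith
    rw [hg, norm_mul, norm_div, norm_cpow_line hx0]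
    have h3 : T ≤ ‖(u : ℂ) + T' * I‖ := by
      have := abs_im_le_norm ((u : ℂ) + T' * I)
      simp only [add_im, ofReal_im, mul_im, ofReal_re, I_im, mul_one, I_re, mul_zero, add_zero,
        zero_add] at this
      rwa [hT'] at this
    have h1 := hW u hu.1.le hu.2
    have hW0 : 0 ≤ W := le_trans (by positivity) h1
    calc ‖F (u + T' * I)‖ * (x ^ u / ‖(u : ℂ) + T' * I‖)
        = ‖F (u + T' * I)‖ * x ^ u / ‖(u : ℂ) + T' * I‖ := by ring
      _ ≤ W / T := div_le_div₀ hW0 h1 hT0 h3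
  have htop := hhor T (abs_of_pos hT0) hW₁
  have hbot := hhor (-T) (by rw [abs_neg, abs_of_pos hT0]) (fun σ h1 h2 ↦ by
    have := hW₂ σ h1 h2; push_cast at this ⊢; exact this)
  rw [abs_of_nonneg (show (0 : ℝ) ≤ c - σ₀ by linarith)] at htop hbot
  push_cast at hbot
  rw [show |T - -T| = 2 * T by rw [sub_neg_eq_add, ← two_mul, abs_of_pos (by positivity)]] at hleft
  -- assemble: `2π Σ = ∫_right − (∫_right − 2π Σ)`, `∫_right = ∫_left + I ∫_bot − I ∫_top`
  have hkey : (2 * π : ℂ) * ∑ n ∈ Finset.Icc 1 N, a n =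
      (∫ t in (-T)..T, g (σ₀ + t * I)) + I * (∫ u in σ₀..c, g (u + (-T) * I)) -
        I * (∫ u in σ₀..c, g (u + T * I)) -
        ((∫ t in (-T)..T, g (c + t * I)) - 2 * π * ∑ n ∈ Finset.Icc 1 N, a n) := by
    linear_combination hrect
  have hnI : ∀ z : ℂ, ‖I * z‖ = ‖z‖ := fun z ↦ by rw [norm_mul, norm_I, one_mul]
  have h2π : ‖(2 * π : ℂ) * ∑ n ∈ Finset.Icc 1 N, a n‖ = 2 * π * ‖∑ n ∈ Finset.Icc 1 N, a n‖ := by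
    rw [norm_mul, show (2 * π : ℂ) = ((2 * π : ℝ) : ℂ) by push_cast; ring, Complex.norm_real,
      Real.norm_of_nonneg (by positivity)]
  have hbound : 2 * π * ‖∑ n ∈ Finset.Icc 1 N, a n‖ ≤
      V * x ^ σ₀ / σ₀ * (2 * T) + W / T * (c - σ₀) + W / T * (c - σ₀) +
        K * x * Real.log x * (1 / T + 1 / T) := by
    rw [← h2π, hkey]
    refine (norm_sub_le _ _).trans (add_le_add ?_ hP)
    refine (norm_sub_le _ _).trans (add_le_add ((norm_add_le _ _).trans (add_le_add hleft ?_)) ?_)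
    · rw [hnI]; exact hbot
    · rw [hnI]; exact htop
  have hπ : (3 : ℝ) < π := Real.pi_gt_three
  have hS := norm_nonneg (∑ n ∈ Finset.Icc 1 N, a n)
  have e1 : V * x ^ σ₀ / σ₀ * (2 * T) = 2 * (T * V * x ^ σ₀ / σ₀) := by ring
  have e2 : W / T * (c - σ₀) + W / T * (c - σ₀) = 2 * ((c - σ₀) * W / T) := by ring
  have e3 : K * x * Real.log x * (1 / T + 1 / T) = 2 * (K * x * Real.log x / T) := by ring
  have hb2 : 2 * π * ‖∑ n ∈ Finset.Icc 1 N, a n‖ ≤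
      2 * (K * x * Real.log x / T + T * V * x ^ σ₀ / σ₀ + (c - σ₀) * W / T) := by linarith
  nlinarith [mul_nonneg (sub_nonneg.2 hπ.le) hS]

end PerronShift

end Literature.NumberTheory.LFunctions

end
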